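import Literature.Probability.Percolation.Z2PivotalMeasureIntegral
import Mathlib.Dynamics.Ergodic.MeasurePreserving
import Mathlib.MeasureTheory.Group.Prod
import Mathlib.MeasureTheory.Function.Floor
import Mathlib.MeasureTheory.Measure.Haar.OfBasis

/-!
# Crux `FlipErgodicityZ2` (stmt-CriticalPhenomena-14825), line `registered`: `stub_latticePivotalAntitone`

Route `Summits/CriticalPhenomena/CardyFormulaZ2/Theses/CardyMeckeFlip`.  **The isometry-averaged
Garban–Pete–Schramm weight of an edge of `δℤ²` is antitone in the cutoff**: for
`0 < δ ≤ ε' ≤ ε`, every lattice configuration `ω ⊆ E(ℤ²)` and every edge `e = s(x, x + eᵢ)`,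

  `pivotalWeight ε δ ω x i ≤ pivotalWeight ε' δ ω x i`,

i.e. the probability (over a uniformly moved `ε`-grid) that `e` is `ε`-important is at most the
probability (over a uniformly moved `ε'`-grid) that it is `ε'`-important — the lattice input of
clause (ADM)(2) ("antitone in the cutoff") for the limit kernel of the crux.

Proof (three layers, all structural).
* **Arms restrict to sub-blocks** (`edgeFourArm_of_subset`): for `W' ⊆ W` containing both
  endpoints of `e` and a lattice configuration, four arms from `e` to `∂W` give four arms to
  `∂W'` — follow each open arm until it first leaves `W'` (induction on the open walk); the
  non-connection clause is monotonicity of `openConnIn` in the vertex set (inlined; the tree's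
  copies of this one-liner live in unrelated heavy files).
* **Coupled grids** (`gridImportant_coupled`): move the shift of the `ε'`-grid (same angle and
  orientation) so that the midpoint `m` of `e` has the SAME relative position `t ∈ [0,1)²` in its
  `ε'`-square as in its `ε`-square.  In grid-frame coordinates the two `3·`-blocks are then
  `m + ε'(X_t)` and `m + ε(X_t)` for the same box `X_t = [-1,2]² - t ∋ 0`, so the `ε'`-block lies
  inside the `ε`-block, and it contains both endpoints of `e` because they are within `δ ≤ ε'` of
  `m` and `t + [-1,1]² ⊆ [-1,2]²`.  The coupling is the translation `a ↦ a + c(θ)` of the shift,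
  `c(θ) = y_θ(m)(1/ε' - 1/ε)`.
* **The coupling preserves the parameter law** (`map_gridParamLaw_skew`): reduced modulo `ℤ²`
  (the grid only depends on the shift modulo `ℤ²`, `gridImportant_add_int`), the coupling is the
  skew translation `(θ, a) ↦ (θ, fract (a + c(θ)))` of `[0,2π) × [0,1)²`, which preserves
  Lebesgue measure (`MeasurePreserving.skew_product` over the one-dimensional fact
  `measurePreserving_fract_add`: `a ↦ fract (a + c)` preserves `Leb|[0,1)`).  The parameter sets
  need not be measurable: `Measure.le_map_apply` is an inequality of outer measures.
-/

noncomputable section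

open MeasureTheory Set Filter Metric
open Literature.Probability.Percolation Literature.Probability.Percolation.QuadCrossing
open Literature.Probability.LatticeModels
open scoped symmDiff ENNReal Topology

namespace Summit.CriticalPhenomena.CardyFormulaZ2.Theorems.CardyMeckeFlip

/-! ### Four arms to the boundary of a block restrict to every sub-block containing the edge -/

/-- **First exit of an open arm.**  On a lattice configuration `ω ⊆ E(ℤ²)`, if `v ∈ W' ⊆ W` is
joined inside `W` by an open path to a site of the vertex boundary of `W`, then it is joined
inside `W'` to a site of the vertex boundary of `W'` (stop the path just before it first leaves
`W'`; if it never does, its endpoint is a boundary site of `W'` as well). [folklore] -/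
theorem exists_vertexBoundary_openConnIn_of_subset {ω : BondConfig (Site 2)}
    (hω : ω ⊆ (zdGraph 2).edgeSet) {W W' : Set (Site 2)} (hW : W' ⊆ W) {v u : Site 2}
    (hv : v ∈ W') (hu : u ∈ vertexBoundary W) (h : ω ∈ openConnIn W v u) :
    ∃ u' ∈ vertexBoundary W', ω ∈ openConnIn W' v u' := by
  obtain ⟨hvW, huW, ⟨p⟩⟩ := h
  suffices key : ∀ (a b : W) (_ : ((openGraph ω).induce W).Walk a b), a.1 ∈ W' →
      b.1 ∈ vertexBoundary W → ∃ u' ∈ vertexBoundary W', ω ∈ openConnIn W' a.1 u' from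
    key ⟨v, hvW⟩ ⟨u, huW⟩ p hv hu
  intro a b q
  induction q with
  | nil =>
    intro ha hb
    obtain ⟨-, w, hw, hadj⟩ := hb
    exact ⟨_, ⟨ha, w, fun h' => hw (hW h'), hadj⟩, ha, ha, SimpleGraph.Reachable.refl _⟩
  | @cons a c b hac q ih =>
    intro ha hb
    rw [SimpleGraph.induce_adj, openGraph_adj] at hac
    by_cases hc : c.1 ∈ W'
    · obtain ⟨u', hu', hcW', hu'W', hreach⟩ := ih hc hb
      refine ⟨u', hu', ha, hu'W', SimpleGraph.Reachable.trans (SimpleGraph.Adj.reachable ?_) hreach⟩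
      rw [SimpleGraph.induce_adj, openGraph_adj]
      exact hac
    · have hadj : (zdGraph 2).Adj a.1 c.1 := (SimpleGraph.mem_edgeSet (zdGraph 2)).1 (hω hac.1)
      exact ⟨a.1, ⟨ha, c.1, hc, hadj⟩, ha, ha, SimpleGraph.Reachable.refl _⟩

/-- **Four arms restrict to sub-blocks.**  On a lattice configuration, four alternating arms
(cluster form, `edgeFourArm`) from the edge `s(x, x + eᵢ)` to the boundary of `W` give four
alternating arms to the boundary of every `W' ⊆ W` containing both endpoints of the edge: the two
open arms are stopped at their first exit from `W'`, and "not joined inside `W`" implies "not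
joined inside `W'`". [folklore] -/
theorem edgeFourArm_of_subset {W W' : Set (Site 2)} (hW : W' ⊆ W) {x : Site 2} {i : Fin 2}
    (hx : x ∈ W') (hxi : x + Pi.single i 1 ∈ W') {ω : BondConfig (Site 2)}
    (hω : ω ⊆ (zdGraph 2).edgeSet) (h : ω ∈ edgeFourArm W x i) : ω ∈ edgeFourArm W' x i := by
  obtain ⟨⟨u, hu, h1⟩, ⟨u', hu', h2⟩, h3⟩ := h
  have hω' : ω \ {edgeFrom x i} ⊆ (zdGraph 2).edgeSet := fun f hf => hω hf.1
  obtain ⟨w, hw, hw1⟩ := exists_vertexBoundary_openConnIn_of_subset hω' hW hx hu h1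
  obtain ⟨w', hw', hw2⟩ := exists_vertexBoundary_openConnIn_of_subset hω' hW hxi hu' h2
  refine ⟨⟨w, hw, hw1⟩, ⟨w', hw', hw2⟩, fun h => h3 ?_⟩
  -- `{x ↔ x + eᵢ in W'}` implies `{x ↔ x + eᵢ in W}` (monotonicity in the vertex set)
  obtain ⟨hx', hy', hr⟩ := h
  exact ⟨hW hx', hW hy', hr.map (SimpleGraph.induceHomOfLE (G := openGraph _) hW).toHom⟩

/-! ### The coupled `ε'`-grid: same relative position of the midpoint, nested blocks -/

/-- Grid coordinates for the `ε'`-grid whose shift is coupled to the shift `a` of the `ε`-grid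
at the point `m` (shift `a + y(m)/ε' - y(m)/ε`, `y` the grid frame): relative to `m` they are
the `ε`-grid coordinates rescaled by `ε/ε'`, with the same value at `m`. [folklore] -/
theorem gridCoord_coupled (ε ε' θ : ℝ) (s : Bool) (a m z : ℂ) :
    gridCoord ε' θ s (a + (gridFrame θ s m / ε' - gridFrame θ s m / ε)) z =
      (gridFrame θ s z - gridFrame θ s m) / ε' + gridCoord ε θ s a m := by
  simp only [gridCoord]
  ring

/-- Grid coordinates relative to a base point `m`. [folklore] -/
theorem gridCoord_eq_sub_add (ε θ : ℝ) (s : Bool) (a m z : ℂ) :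
    gridCoord ε θ s a z = (gridFrame θ s z - gridFrame θ s m) / ε + gridCoord ε θ s a m := by
  simp only [gridCoord]
  ring

/-- The coupled `ε'`-grid puts `m` in the square with the same index. [folklore] -/
theorem gridIndex_coupled (ε ε' θ : ℝ) (s : Bool) (a m : ℂ) :
    gridIndex ε' θ s (a + (gridFrame θ s m / ε' - gridFrame θ s m / ε)) m =
      gridIndex ε θ s a m := by
  simp only [gridIndex, gridCoord_coupled, sub_self, zero_div, zero_add]

/-- Interval bookkeeping for nested blocks: if `r/ε' + c ∈ [⌊c⌋ - 1, ⌊c⌋ + 2]` and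
`0 < ε' ≤ ε`, then `r/ε + c ∈ [⌊c⌋ - 1, ⌊c⌋ + 2]` (the box `[-1,2] - fract c` contains `0`,
hence is star-shaped about it). [folklore] -/
theorem floor_box_of_div_le {ε ε' r c : ℝ} (hε' : 0 < ε') (hle : ε' ≤ ε)
    (hlo : (⌊c⌋ : ℝ) - 1 ≤ r / ε' + c) (hhi : r / ε' + c ≤ ⌊c⌋ + 2) :
    (⌊c⌋ : ℝ) - 1 ≤ r / ε + c ∧ r / ε + c ≤ ⌊c⌋ + 2 := by
  have hε : 0 < ε := hε'.trans_le hle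
  have hc1 := Int.floor_le c
  have hc2 := Int.lt_floor_add_one c
  rcases le_or_gt 0 r with hr | hr
  · have hmono : r / ε ≤ r / ε' := div_le_div_of_nonneg_left hr hε' hle
    have hnn : 0 ≤ r / ε := div_nonneg hr hε.le
    constructor <;> linarith
  · have hmono : r / ε' ≤ r / ε := by
      rw [div_le_div_iff₀ hε' hε]
      nlinarith
    have hnp : r / ε ≤ 0 := (div_neg_of_neg_of_pos hr hε).le
    constructor <;> linarith

/-- Interval bookkeeping for the endpoints: if `|r| ≤ ε'` then `r/ε' + c ∈ [⌊c⌋ - 1, ⌊c⌋ + 2]`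
(`fract c + [-1,1] ⊆ [-1,2]`). [folklore] -/
theorem floor_box_of_abs_le {ε' r c : ℝ} (hε' : 0 < ε') (hr : |r| ≤ ε') :
    (⌊c⌋ : ℝ) - 1 ≤ r / ε' + c ∧ r / ε' + c ≤ ⌊c⌋ + 2 := by
  have hc1 := Int.floor_le c
  have hc2 := Int.lt_floor_add_one c
  rw [abs_le] at hr
  have h1 : -1 ≤ r / ε' := by rw [le_div_iff₀ hε']; linarith
  have h2 : r / ε' ≤ 1 := by rw [div_le_iff₀ hε']; linarith
  constructor <;> linarith

/-- **The coupled `3ε'`-block lies inside the `3ε`-block** (`0 < ε' ≤ ε`). [folklore] -/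
theorem gridBlock_coupled_subset {ε ε' : ℝ} (hε' : 0 < ε') (hle : ε' ≤ ε) (θ : ℝ) (s : Bool)
    (a : ℂ) (δ : ℝ) (m : ℂ) :
    gridBlock ε' θ s (a + (gridFrame θ s m / ε' - gridFrame θ s m / ε)) δ (gridIndex ε θ s a m) ⊆
      gridBlock ε θ s a δ (gridIndex ε θ s a m) := by
  intro v hv
  simp only [gridBlock, mem_setOf_eq, mem_Icc, gridIndex, gridCoord_coupled, Complex.add_re,
    Complex.add_im, Complex.div_ofReal_re, Complex.div_ofReal_im] at hv
  simp only [gridBlock, mem_setOf_eq, mem_Icc, gridIndex]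
  rw [gridCoord_eq_sub_add ε θ s a m (meshPoint δ v)]
  simp only [Complex.add_re, Complex.add_im, Complex.div_ofReal_re, Complex.div_ofReal_im]
  obtain ⟨⟨hv1, hv2⟩, hv3, hv4⟩ := hv
  exact ⟨floor_box_of_div_le hε' hle hv1 hv2, floor_box_of_div_le hε' hle hv3 hv4⟩

/-- **A site drawn within `ε'` of `m` lies in the coupled `3ε'`-block.** [folklore] -/
theorem mem_gridBlock_coupled_of_norm_le {ε ε' δ : ℝ} (hε' : 0 < ε') (θ : ℝ) (s : Bool)
    (a m : ℂ) {v : Site 2} (hv : ‖meshPoint δ v - m‖ ≤ ε') :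
    v ∈ gridBlock ε' θ s (a + (gridFrame θ s m / ε' - gridFrame θ s m / ε)) δ
      (gridIndex ε θ s a m) := by
  simp only [gridBlock, mem_setOf_eq, mem_Icc, gridIndex, gridCoord_coupled, Complex.add_re,
    Complex.add_im, Complex.div_ofReal_re, Complex.div_ofReal_im]
  have hD : ‖gridFrame θ s (meshPoint δ v) - gridFrame θ s m‖ ≤ ε' := by
    rw [gridFrame_sub, norm_gridFrame]
    exact hv
  exact ⟨floor_box_of_abs_le hε' ((Complex.abs_re_le_norm _).trans hD),
    floor_box_of_abs_le hε' ((Complex.abs_im_le_norm _).trans hD)⟩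

/-- Both endpoints of a drawn edge are within `δ` of its midpoint (`0 < δ`). [folklore] -/
theorem norm_endpoints_sub_edgeMidpoint_le {δ : ℝ} (hδ : 0 < δ) (x : Site 2) (i : Fin 2) :
    ‖meshPoint δ x - edgeMidpoint δ x i‖ ≤ δ ∧
      ‖meshPoint δ (x + Pi.single i 1) - edgeMidpoint δ x i‖ ≤ δ := by
  have h := dist_meshPoint_edgeMidpoint_le hδ x i
  rw [dist_eq_norm] at h
  have e : meshPoint δ (x + Pi.single i 1) - edgeMidpoint δ x i =
      -(meshPoint δ x - edgeMidpoint δ x i) := by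
    simp only [edgeMidpoint]
    ring
  rw [e, norm_neg]
  exact ⟨h, h⟩

/-- **Coupled grids: `ε`-important implies `ε'`-important** (`0 < δ ≤ ε' ≤ ε`, lattice
configuration).  With the shift of the `ε'`-grid coupled to the shift `a` of the `ε`-grid at the
midpoint of the edge, the `3ε'`-block is inside the `3ε`-block and contains both endpoints, so
four arms to the boundary of the latter give four arms to the boundary of the former. [folklore] -/
theorem gridImportant_coupled {ε ε' δ : ℝ} (hδ : 0 < δ) (hδε' : δ ≤ ε') (hle : ε' ≤ ε) (θ : ℝ)
    (s : Bool) (a : ℂ) {ω : BondConfig (Site 2)} (hω : ω ⊆ (zdGraph 2).edgeSet) (x : Site 2)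
    (i : Fin 2) (h : ω ∈ gridImportant ε θ s a δ x i) :
    ω ∈ gridImportant ε' θ s
      (a + (gridFrame θ s (edgeMidpoint δ x i) / ε' - gridFrame θ s (edgeMidpoint δ x i) / ε))
      δ x i := by
  have hε' : 0 < ε' := hδ.trans_le hδε'
  have hend := norm_endpoints_sub_edgeMidpoint_le hδ x i
  unfold gridImportant at h ⊢
  rw [gridIndex_coupled]
  exact edgeFourArm_of_subset (gridBlock_coupled_subset hε' hle θ s a δ _)
    (mem_gridBlock_coupled_of_norm_le hε' θ s a _ (hend.1.trans hδε'))
    (mem_gridBlock_coupled_of_norm_le hε' θ s a _ (hend.2.trans hδε')) hω h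

/-- Reducing the coupled shift modulo `ℤ²` (componentwise fractional parts) does not change
`ε`-importance (`gridImportant_add_int`). [folklore] -/
theorem gridImportant_fract_add (ε θ : ℝ) (s : Bool) (a₁ a₂ : ℝ) (d : ℂ) (δ : ℝ) (x : Site 2)
    (i : Fin 2) :
    gridImportant ε θ s ⟨Int.fract (a₁ + d.re), Int.fract (a₂ + d.im)⟩ δ x i =
      gridImportant ε θ s (⟨a₁, a₂⟩ + d) δ x i := by
  rw [← gridImportant_add_int ε θ s (⟨a₁, a₂⟩ + d) δ (-⌊a₁ + d.re⌋, -⌊a₂ + d.im⌋) x i]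
  congr 1
  apply Complex.ext
  · simp only [Complex.add_re, Int.cast_neg, Int.fract]
    ring
  · simp only [Complex.add_im, Int.cast_neg, Int.fract]
    ring

/-! ### The skew translation of the shifts preserves the parameter law -/

/-- **Translations of the circle preserve Lebesgue measure on `[0,1)`**: for every real `c`,
`a ↦ fract (a + c)` pushes `Leb|[0,1)` forward to itself (split `[0,1)` at `1 - fract c`; on
each piece the map is a translation of the line). [folklore] -/
theorem measurePreserving_fract_add (c : ℝ) :
    MeasurePreserving (fun a : ℝ => Int.fract (a + c)) (volume.restrict (Ico 0 1))
      (volume.restrict (Ico 0 1)) := by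
  have hmeas : Measurable fun a : ℝ => Int.fract (a + c) :=
    measurable_fract.comp (measurable_id.add_const c)
  refine ⟨hmeas, ?_⟩
  set c' := Int.fract c with hc'
  have hc0 : 0 ≤ c' := Int.fract_nonneg c
  have hc1 : c' < 1 := Int.fract_lt_one c
  have hcc : c' + (⌊c⌋ : ℝ) = c := by rw [hc', Int.fract_add_floor]
  have hsplit : (volume : Measure ℝ).restrict (Ico 0 1) =
      volume.restrict (Ico 0 (1 - c')) + volume.restrict (Ico (1 - c') 1) := by
    rw [← Measure.restrict_union Ico_disjoint_Ico_same measurableSet_Ico,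
      Ico_union_Ico_eq_Ico (by linarith) (by linarith)]
  have hpiece₁ : Measure.map (fun a : ℝ => Int.fract (a + c)) (volume.restrict (Ico 0 (1 - c'))) =
      volume.restrict (Ico c' 1) := by
    have hcongr : (fun a : ℝ => Int.fract (a + c)) =ᵐ[volume.restrict (Ico 0 (1 - c'))]
        fun a => a + c' := by
      filter_upwards [ae_restrict_mem measurableSet_Ico] with a ha
      rw [show a + c = (a + c') + ((⌊c⌋ : ℤ) : ℝ) by linear_combination -hcc,
        Int.fract_add_intCast, Int.fract_eq_self.2 ⟨by linarith [ha.1], by linarith [ha.2]⟩]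
    have hpre : (fun a : ℝ => a + c') ⁻¹' Ico c' 1 = Ico 0 (1 - c') := by
      rw [Set.preimage_add_const_Ico, sub_self]
    rw [Measure.map_congr hcongr, ← hpre,
      ← Measure.restrict_map (measurable_add_const c') measurableSet_Ico, map_add_right_eq_self]
  have hpiece₂ : Measure.map (fun a : ℝ => Int.fract (a + c)) (volume.restrict (Ico (1 - c') 1)) =
      volume.restrict (Ico 0 c') := by
    have hcongr : (fun a : ℝ => Int.fract (a + c)) =ᵐ[volume.restrict (Ico (1 - c') 1)]
        fun a => a + (c' - 1) := by
      filter_upwards [ae_restrict_mem measurableSet_Ico] with a ha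
      rw [show a + c = (a + (c' - 1)) + ((⌊c⌋ + 1 : ℤ) : ℝ) by
          push_cast; linear_combination -hcc,
        Int.fract_add_intCast, Int.fract_eq_self.2 ⟨by linarith [ha.1], by linarith [ha.2]⟩]
    have hpre : (fun a : ℝ => a + (c' - 1)) ⁻¹' Ico 0 c' = Ico (1 - c') 1 := by
      rw [Set.preimage_add_const_Ico]
      congr 1 <;> ring
    rw [Measure.map_congr hcongr, ← hpre,
      ← Measure.restrict_map (measurable_add_const _) measurableSet_Ico, map_add_right_eq_self]
  calc Measure.map (fun a : ℝ => Int.fract (a + c)) (volume.restrict (Ico 0 1))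
      = Measure.map (fun a : ℝ => Int.fract (a + c))
          (volume.restrict (Ico 0 (1 - c')) + volume.restrict (Ico (1 - c') 1)) := by rw [hsplit]
    _ = volume.restrict (Ico c' 1) + volume.restrict (Ico 0 c') := by
        rw [Measure.map_add _ _ hmeas, hpiece₁, hpiece₂]
    _ = volume.restrict (Ico 0 1) := by
        rw [add_comm, ← Measure.restrict_union Ico_disjoint_Ico_same measurableSet_Ico,
          Ico_union_Ico_eq_Ico hc0 hc1.le]

/-- Lebesgue measure restricted to the parameter box is the product of its restrictions to the
factors. [folklore] -/
theorem volume_restrict_gridParamSet :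
    (volume : Measure (ℝ × ℝ × ℝ)).restrict gridParamSet =
      (volume.restrict (Ico 0 (2 * Real.pi))).prod
        ((volume.restrict (Ico 0 1)).prod (volume.restrict (Ico 0 1))) := by
  simp only [gridParamSet, Measure.volume_eq_prod, Measure.prod_restrict]

/-- **The skew translation `(θ, a) ↦ (θ, fract (a + d(θ)))` of the shifts preserves Lebesgue
measure on the parameter box** `[0,2π) × [0,1)²`, for every measurable displacement
`d : ℝ → ℂ` (`MeasurePreserving.skew_product` over `measurePreserving_fract_add`). [folklore] -/
theorem measurePreserving_gridParam_skew {d : ℝ → ℂ} (hd : Measurable d) :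
    MeasurePreserving
      (fun q : ℝ × ℝ × ℝ => (q.1, Int.fract (q.2.1 + (d q.1).re), Int.fract (q.2.2 + (d q.1).im)))
      (volume.restrict gridParamSet) (volume.restrict gridParamSet) := by
  rw [volume_restrict_gridParamSet]
  refine MeasurePreserving.skew_product (f := id)
    (g := fun (θ : ℝ) (a : ℝ × ℝ) => (Int.fract (a.1 + (d θ).re), Int.fract (a.2 + (d θ).im)))
    (MeasurePreserving.id _) ?_ (ae_of_all _ fun θ => ?_)
  · exact (measurable_fract.comp
      (measurable_snd.fst.add (Complex.measurable_re.comp (hd.comp measurable_fst)))).prodMk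
      (measurable_fract.comp
        (measurable_snd.snd.add (Complex.measurable_im.comp (hd.comp measurable_fst))))
  · exact ((measurePreserving_fract_add (d θ).re).prod
      (measurePreserving_fract_add (d θ).im)).map_eq

/-- **The skew translation preserves the parameter law** `gridParamLaw`
(= Lebesgue measure conditioned on the parameter box). [folklore] -/
theorem map_gridParamLaw_skew {d : ℝ → ℂ} (hd : Measurable d) :
    Measure.map
        (fun q : ℝ × ℝ × ℝ => (q.1, Int.fract (q.2.1 + (d q.1).re), Int.fract (q.2.2 + (d q.1).im)))
        gridParamLaw = gridParamLaw := by
  show Measure.map _ (ProbabilityTheory.cond volume gridParamSet) =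
    ProbabilityTheory.cond volume gridParamSet
  rw [ProbabilityTheory.cond, Measure.map_smul, (measurePreserving_gridParam_skew hd).map_eq]

/-- The grid frame depends continuously on the angle. [folklore] -/
theorem continuous_gridFrame (s : Bool) (z : ℂ) : Continuous fun θ : ℝ => gridFrame θ s z := by
  have h : Continuous fun θ : ℝ => Complex.exp (-(θ * Complex.I)) * z := by fun_prop
  cases s with
  | false => exact h
  | true => exact Complex.continuous_conj.comp h

/-! ### Antitonicity of the averaged weight in the cutoff -/

/-- **For each orientation, the probability that the edge is `ε`-important for a uniformly moved
`ε`-grid is at most the probability that it is `ε'`-important for a uniformly moved `ε'`-grid**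
(`0 < δ ≤ ε' ≤ ε`, lattice configuration): the set of `ε`-good parameters is carried into the
set of `ε'`-good parameters by the law-preserving skew translation of the shifts. [folklore] -/
theorem gridParamLaw_setOf_gridImportant_le {ε ε' δ : ℝ} (hδ : 0 < δ) (hδε' : δ ≤ ε')
    (hle : ε' ≤ ε) {ω : BondConfig (Site 2)} (hω : ω ⊆ (zdGraph 2).edgeSet) (x : Site 2)
    (i : Fin 2) (s : Bool) :
    gridParamLaw {q | ω ∈ gridImportant ε q.1 s (gridShift q) δ x i} ≤
      gridParamLaw {q | ω ∈ gridImportant ε' q.1 s (gridShift q) δ x i} := by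
  have hdm : Measurable fun θ : ℝ =>
      gridFrame θ s (edgeMidpoint δ x i) / ε' - gridFrame θ s (edgeMidpoint δ x i) / ε :=
    (((continuous_gridFrame s _).div_const _).sub
      ((continuous_gridFrame s _).div_const _)).measurable
  have hmp := measurePreserving_gridParam_skew hdm
  refine (measure_mono ?_).trans ((Measure.le_map_apply hmp.measurable.aemeasurable
    {q : ℝ × ℝ × ℝ | ω ∈ gridImportant ε' q.1 s (gridShift q) δ x i}).trans_eq ?_)
  · rintro ⟨θ, a₁, a₂⟩ hq
    have key := gridImportant_coupled hδ hδε' hle θ s ⟨a₁, a₂⟩ hω x i hq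
    simp only [mem_preimage, mem_setOf_eq, gridShift]
    rw [gridImportant_fract_add]
    exact key
  · rw [map_gridParamLaw_skew hdm]

/-! ### The registered stub -/

/-- **Stub 1a of the birth skeleton of crux `FlipErgodicityZ2` — lattice antitonicity of the
isometry-averaged GPS weight in the cutoff**, verbatim the registered signature: for
`0 < δ ≤ ε' ≤ ε`, every lattice configuration `ω ⊆ E(ℤ²)` and every edge `s(x, x + eᵢ)` of
`δℤ²`, `pivotalWeight ε δ ω x i ≤ pivotalWeight ε' δ ω x i`. [folklore] -/
theorem stub_latticePivotalAntitone :
    ∀ (ε ε' δ : ℝ), 0 < δ → δ ≤ ε' → ε' ≤ ε →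
      ∀ (ω : BondConfig (Site 2)), ω ⊆ (zdGraph 2).edgeSet → ∀ (x : Site 2) (i : Fin 2),
        pivotalWeight ε δ ω x i ≤ pivotalWeight ε' δ ω x i := by
  intro ε ε' δ hδ hδε' hle ω hω x i
  unfold pivotalWeight
  gcongr ENNReal.ofReal (pivotalRate δ) * ((?_ + ?_) / 2)
  · exact gridParamLaw_setOf_gridImportant_le hδ hδε' hle hω x i false
  · exact gridParamLaw_setOf_gridImportant_le hδ hδε' hle hω x i true

end Summit.CriticalPhenomena.CardyFormulaZ2.Theorems.CardyMeckeFlip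

end
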